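import Literature.Analysis.Convolution.OneSidedConvolution
import HarnessLib

/-!
# One-sided convolution: Lipschitz continuity for a piecewise Lipschitz factor

Companion of `OneSidedConvolution.lean` (everything PROVED). If `f` is bounded by `C_f`,
`L`-Lipschitz on a window `[p, q)` and zero off `[p, q)` (so it may JUMP at `p` and at `q`), and
`g` is bounded by `C_g` on `[-X, X]`, then `f ⋆ g` is Lipschitz on `[0, X]`:

  `|(f ⋆ g)(x) − (f ⋆ g)(y)| ≤ (C_g (L X + 2 C_f) + C_f C_g) (x − y)`   (`0 ≤ y ≤ x ≤ X`)

(`abs_oconv_sub_oconv_le`), from the pointwise increment bound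
`|f(u+h) − f(u)| ≤ L h + C_f (𝟙_{[p−h,p)} + 𝟙_{[q−h,q)})(u)` (`abs_sub_le_of_pieceLipschitz`): the two
jumps only cost `2 C_f h` after integration. Used to show that the convolution powers of the
truncated Dickman-type kernel — hence Ford–Maynard's modified Liouville functions — are
Lipschitz on the pieces of Definition 6.2 (b) of arXiv:2407.14368.
-/

noncomputable section

namespace Literature.Analysis.Convolution

open MeasureTheory Set

/-! ### Lipschitz continuity of `f ⋆ g` for a piecewise Lipschitz factor -/

section Lipschitz

variable {f g : ℝ → ℝ}

/-- Pointwise increment bound for a function that is `L`-Lipschitz on `[p, q)`, bounded by `Cf`,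
and zero off `[p, q)`: `|f(u+h) − f(u)| ≤ L h + Cf (𝟙_{[p−h,p)}(u) + 𝟙_{[q−h,q)}(u))` (`h ≥ 0`).
[folklore] -/
theorem abs_sub_le_of_pieceLipschitz {p q L Cf : ℝ} (hL : 0 ≤ L)
    (hf0 : ∀ t, t < p → f t = 0) (hf1 : ∀ t, q ≤ t → f t = 0) (hCf : ∀ t, |f t| ≤ Cf)
    (hLip : ∀ s t, s ∈ Set.Ico p q → t ∈ Set.Ico p q → |f s - f t| ≤ L * |s - t|)
    {h : ℝ} (hh : 0 ≤ h) (u : ℝ) :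
    |f (u + h) - f u| ≤ L * h + Cf * ((Set.Ico (p - h) p).indicator 1 u + (Set.Ico (q - h) q).indicator 1 u) := by
  have hCf0 : 0 ≤ Cf := (abs_nonneg _).trans (hCf 0)
  have hA : 0 ≤ (Set.Ico (p - h) p).indicator (1 : ℝ → ℝ) u := Set.indicator_nonneg (fun _ _ => zero_le_one) u
  have hB : 0 ≤ (Set.Ico (q - h) q).indicator (1 : ℝ → ℝ) u := Set.indicator_nonneg (fun _ _ => zero_le_one) u
  by_cases h1 : u + h < p
  · rw [hf0 _ h1, hf0 u (by linarith), sub_zero, abs_zero]; positivity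
  by_cases h2 : u < p
  · -- `u ∈ [p - h, p)`
    rw [Set.indicator_of_mem (show u ∈ Set.Ico (p - h) p from ⟨by linarith, h2⟩), hf0 u h2, sub_zero]
    simp only [Pi.one_apply]
    nlinarith [hCf (u + h)]
  by_cases h3 : q ≤ u
  · rw [hf1 _ (by linarith), hf1 u h3, sub_zero, abs_zero]; positivity
  by_cases h4 : q ≤ u + h
  · -- `u ∈ [q - h, q)`
    rw [Set.indicator_of_mem (show u ∈ Set.Ico (q - h) q from ⟨by linarith, not_le.1 h3⟩), hf1 _ h4,
      zero_sub, abs_neg]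
    simp only [Pi.one_apply]
    nlinarith [hCf u]
  · -- both in `[p, q)`
    have := hLip (u + h) u ⟨by linarith, not_le.1 h4⟩ ⟨not_lt.1 h2, not_le.1 h3⟩
    rw [show u + h - u = h by ring, abs_of_nonneg hh] at this
    nlinarith

/-- **`f ⋆ g` is Lipschitz on `[0, X]`** when `f` is bounded, `L`-Lipschitz on `[p, q)` and zero off
`[p, q)`, and `g` is bounded on `[−X, X]`: for `0 ≤ y ≤ x ≤ X`,
`|(f ⋆ g)(x) − (f ⋆ g)(y)| ≤ (C_g (L X + 2 C_f) + C_f C_g)(x − y)`. [folklore] -/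
theorem abs_oconv_sub_oconv_le (hf : LocBdd f) (hg : LocBdd g) {p q L Cf : ℝ} (hL : 0 ≤ L)
    (hf0 : ∀ t, t < p → f t = 0) (hf1 : ∀ t, q ≤ t → f t = 0) (hCf : ∀ t, |f t| ≤ Cf)
    (hLip : ∀ s t, s ∈ Set.Ico p q → t ∈ Set.Ico p q → |f s - f t| ≤ L * |s - t|)
    {X Cg : ℝ} (hCg : ∀ t, |t| ≤ X → |g t| ≤ Cg) {x y : ℝ} (hy : 0 ≤ y) (hyx : y ≤ x) (hx : x ≤ X) :
    |oconv f g x - oconv f g y| ≤ (Cg * (L * X + 2 * Cf) + Cf * Cg) * (x - y) := by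
  have hCf0 : 0 ≤ Cf := (abs_nonneg _).trans (hCf 0)
  have hCg0 : 0 ≤ Cg := (abs_nonneg _).trans (hCg 0 (by rw [abs_zero]; linarith))
  set hstep := x - y with hh
  have hh0 : 0 ≤ x - y := by linarith
  rw [oconv_comm]
  simp only [oconv]
  -- split the `x`-integral at `y`
  have hint := integrableOn_integrand hg hf x
  have hsplit : ∫ s in Set.Ioc 0 x, g s * f (x - s) =
      (∫ s in Set.Ioc 0 y, g s * f (x - s)) + ∫ s in Set.Ioc y x, g s * f (x - s) := by
    rw [← setIntegral_union (Set.Ioc_disjoint_Ioc_of_le le_rfl) measurableSet_Ioc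
      (hint.mono_set (Set.Ioc_subset_Ioc_right hyx)) (hint.mono_set (Set.Ioc_subset_Ioc_left hy)),
      Set.Ioc_union_Ioc_eq_Ioc hy hyx]
  rw [hsplit, add_sub_right_comm, ← integral_sub (hint.mono_set (Set.Ioc_subset_Ioc_right hyx))
    (integrableOn_integrand hg hf y)]
  -- second piece
  have h2 : |∫ s in Set.Ioc y x, g s * f (x - s)| ≤ Cg * Cf * (x - y) := by
    have hb : ∀ s ∈ Set.Ioc y x, ‖g s * f (x - s)‖ ≤ Cg * Cf := fun s hs => by
      rw [Real.norm_eq_abs, abs_mul]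
      exact mul_le_mul (hCg s (abs_le.2 ⟨by linarith [hs.1], hs.2.trans hx⟩)) (hCf _) (abs_nonneg _) hCg0
    have := norm_setIntegral_le_of_norm_le_const (measure_Ioc_lt_top (μ := volume)) hb
    rw [Real.norm_eq_abs, Measure.real, Real.volume_Ioc, ENNReal.toReal_ofReal hh0] at this
    linarith
  -- first piece: pointwise bound of the increment
  have h1 : |∫ s in Set.Ioc 0 y, (g s * f (x - s) - g s * f (y - s))| ≤ Cg * (L * (x - y) * y + 2 * Cf * (x - y)) := by
    set A : Set ℝ := Set.Ioc (y - p) (y - p + (x - y)) with hAdef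
    set B : Set ℝ := Set.Ioc (y - q) (y - q + (x - y)) with hBdef
    have hptw : ∀ s ∈ Set.Ioc 0 y, ‖g s * f (x - s) - g s * f (y - s)‖ ≤
        Cg * (L * (x - y) + Cf * (A.indicator 1 s + B.indicator 1 s)) := by
      intro s hs
      rw [Real.norm_eq_abs, ← mul_sub, abs_mul]
      have hgs : |g s| ≤ Cg := hCg s (abs_le.2 ⟨by linarith [hs.1], by linarith [hs.2]⟩)
      have key := abs_sub_le_of_pieceLipschitz hL hf0 hf1 hCf hLip hh0 (y - s)
      rw [show y - s + (x - y) = x - s by ring] at key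
      -- translate the indicators from `u = y - s` to `s`
      have hIA : (Set.Ico (p - (x - y)) p).indicator (1 : ℝ → ℝ) (y - s) = A.indicator 1 s := by
        simp only [Set.indicator, Set.mem_Ico, hAdef, Set.mem_Ioc, Pi.one_apply]
        by_cases hc : y - p < s ∧ s ≤ y - p + (x - y)
        · rw [if_pos ⟨by linarith [hc.2], by linarith [hc.1]⟩, if_pos hc]
        · rw [if_neg, if_neg hc]
          rintro ⟨h1, h2⟩; exact hc ⟨by linarith, by linarith⟩
      have hIB : (Set.Ico (q - (x - y)) q).indicator (1 : ℝ → ℝ) (y - s) = B.indicator 1 s := by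
        simp only [Set.indicator, Set.mem_Ico, hBdef, Set.mem_Ioc, Pi.one_apply]
        by_cases hc : y - q < s ∧ s ≤ y - q + (x - y)
        · rw [if_pos ⟨by linarith [hc.2], by linarith [hc.1]⟩, if_pos hc]
        · rw [if_neg, if_neg hc]
          rintro ⟨h1, h2⟩; exact hc ⟨by linarith, by linarith⟩
      rw [hIA, hIB] at key
      have hnn : 0 ≤ L * (x - y) + Cf * (A.indicator 1 s + B.indicator 1 s) := by
        have : 0 ≤ A.indicator (1 : ℝ → ℝ) s := Set.indicator_nonneg (fun _ _ => zero_le_one) s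
        have : 0 ≤ B.indicator (1 : ℝ → ℝ) s := Set.indicator_nonneg (fun _ _ => zero_le_one) s
        positivity
      calc |g s| * |f (x - s) - f (y - s)| ≤ Cg * (L * (x - y) + Cf * (A.indicator 1 s + B.indicator 1 s)) :=
            mul_le_mul hgs key (abs_nonneg _) hCg0
        _ = _ := rfl
    -- integrate the bound
    have hfin : volume (Set.Ioc 0 y) ≠ ⊤ := by rw [Real.volume_Ioc]; exact ENNReal.ofReal_ne_top
    have hIA : IntegrableOn (A.indicator (1 : ℝ → ℝ)) (Set.Ioc 0 y) :=
      (integrableOn_const hfin).indicator measurableSet_Ioc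
    have hIB : IntegrableOn (B.indicator (1 : ℝ → ℝ)) (Set.Ioc 0 y) :=
      (integrableOn_const hfin).indicator measurableSet_Ioc
    have hG : IntegrableOn (fun s => Cg * (L * (x - y) + Cf * (A.indicator 1 s + B.indicator 1 s)))
        (Set.Ioc 0 y) :=
      ((integrableOn_const hfin).add ((hIA.add hIB).const_mul Cf)).const_mul Cg
    have hmA : ∫ s in Set.Ioc 0 y, A.indicator (1 : ℝ → ℝ) s ≤ x - y := by
      rw [setIntegral_indicator measurableSet_Ioc]
      simp only [Pi.one_apply]
      rw [setIntegral_const, smul_eq_mul, mul_one]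
      calc volume.real (Set.Ioc 0 y ∩ A) ≤ volume.real A :=
            measureReal_mono Set.inter_subset_right (by rw [hAdef, Real.volume_Ioc]; exact ENNReal.ofReal_ne_top)
        _ = x - y := by rw [hAdef, Measure.real, Real.volume_Ioc, ENNReal.toReal_ofReal (by linarith)]; ring
    have hmB : ∫ s in Set.Ioc 0 y, B.indicator (1 : ℝ → ℝ) s ≤ x - y := by
      rw [setIntegral_indicator measurableSet_Ioc]
      simp only [Pi.one_apply]
      rw [setIntegral_const, smul_eq_mul, mul_one]
      calc volume.real (Set.Ioc 0 y ∩ B) ≤ volume.real B :=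
            measureReal_mono Set.inter_subset_right (by rw [hBdef, Real.volume_Ioc]; exact ENNReal.ofReal_ne_top)
        _ = x - y := by rw [hBdef, Measure.real, Real.volume_Ioc, ENNReal.toReal_ofReal (by linarith)]; ring
    calc |∫ s in Set.Ioc 0 y, (g s * f (x - s) - g s * f (y - s))|
        ≤ ∫ s in Set.Ioc 0 y, Cg * (L * (x - y) + Cf * (A.indicator 1 s + B.indicator 1 s)) := by
          have := norm_integral_le_of_norm_le hG ((ae_restrict_iff' measurableSet_Ioc).2
            (Filter.Eventually.of_forall hptw))
          rwa [Real.norm_eq_abs] at this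
      _ = Cg * (L * (x - y) * y + Cf * ((∫ s in Set.Ioc 0 y, A.indicator (1 : ℝ → ℝ) s)
            + ∫ s in Set.Ioc 0 y, B.indicator (1 : ℝ → ℝ) s)) := by
          have hc : IntegrableOn (fun _ : ℝ => L * (x - y)) (Set.Ioc 0 y) := integrableOn_const hfin
          have hsum : IntegrableOn (fun s => A.indicator (1 : ℝ → ℝ) s + B.indicator (1 : ℝ → ℝ) s)
              (Set.Ioc 0 y) := hIA.add hIB
          have hsum' : IntegrableOn (fun s => Cf * (A.indicator (1 : ℝ → ℝ) s + B.indicator (1 : ℝ → ℝ) s))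
              (Set.Ioc 0 y) := hsum.const_mul Cf
          rw [integral_const_mul, integral_add hc hsum', setIntegral_const, integral_const_mul Cf,
            integral_add hIA hIB, smul_eq_mul, Measure.real, Real.volume_Ioc, sub_zero,
            ENNReal.toReal_ofReal hy]
          ring
      _ ≤ Cg * (L * (x - y) * y + 2 * Cf * (x - y)) := by
          apply mul_le_mul_of_nonneg_left _ hCg0
          nlinarith [mul_le_mul_of_nonneg_left (add_le_add hmA hmB) hCf0]
  -- assemble
  calc |(∫ s in Set.Ioc 0 y, (g s * f (x - s) - g s * f (y - s))) + ∫ s in Set.Ioc y x, g s * f (x - s)|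
      ≤ |∫ s in Set.Ioc 0 y, (g s * f (x - s) - g s * f (y - s))| + |∫ s in Set.Ioc y x, g s * f (x - s)| :=
        abs_add_le _ _
    _ ≤ Cg * (L * (x - y) * y + 2 * Cf * (x - y)) + Cg * Cf * (x - y) := add_le_add h1 h2
    _ ≤ (Cg * (L * X + 2 * Cf) + Cf * Cg) * (x - y) := by
        have hyX : y ≤ X := hyx.trans hx
        have : Cg * (L * (x - y) * y) ≤ Cg * (L * (x - y) * X) :=
          mul_le_mul_of_nonneg_left (mul_le_mul_of_nonneg_left hyX (mul_nonneg hL hh0)) hCg0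
        nlinarith

end Lipschitz

end Literature.Analysis.Convolution
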